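import Literature.NumberTheory.LFunctions.WeilTwoPrimeOddMarginKBase
import Literature.NumberTheory.LFunctions.WeilBlockRows
import HarnessLib

/-!
# Two-prime odd-margin certificate K: rows 36–53 of the check `D C = I` (odd block)

Part of the odd-block check of `weilCert23K` (`WeilCert.checkDCRow`), `decide +kernel` row by row. Pure proof file; nothing is asserted.
-/

noncomputable section

namespace Literature.NumberTheory.LFunctions

set_option maxHeartbeats 0 in
/-- Kernel check of row 36 of `D C = I` (certificate K). [folklore] -/
theorem checkDCRow1_36_weilCert23K : weilCert23KBase.checkDCRow 1 36 = true := by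
  decide +kernel

set_option maxHeartbeats 0 in
/-- Kernel check of row 37 of `D C = I` (certificate K). [folklore] -/
theorem checkDCRow1_37_weilCert23K : weilCert23KBase.checkDCRow 1 37 = true := by
  decide +kernel

set_option maxHeartbeats 0 in
/-- Kernel check of row 38 of `D C = I` (certificate K). [folklore] -/
theorem checkDCRow1_38_weilCert23K : weilCert23KBase.checkDCRow 1 38 = true := by
  decide +kernel

set_option maxHeartbeats 0 in
/-- Kernel check of row 39 of `D C = I` (certificate K). [folklore] -/
theorem checkDCRow1_39_weilCert23K : weilCert23KBase.checkDCRow 1 39 = true := by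
  decide +kernel

set_option maxHeartbeats 0 in
/-- Kernel check of row 40 of `D C = I` (certificate K). [folklore] -/
theorem checkDCRow1_40_weilCert23K : weilCert23KBase.checkDCRow 1 40 = true := by
  decide +kernel

set_option maxHeartbeats 0 in
/-- Kernel check of row 41 of `D C = I` (certificate K). [folklore] -/
theorem checkDCRow1_41_weilCert23K : weilCert23KBase.checkDCRow 1 41 = true := by
  decide +kernel

set_option maxHeartbeats 0 in
/-- Kernel check of row 42 of `D C = I` (certificate K). [folklore] -/
theorem checkDCRow1_42_weilCert23K : weilCert23KBase.checkDCRow 1 42 = true := by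
  decide +kernel

set_option maxHeartbeats 0 in
/-- Kernel check of row 43 of `D C = I` (certificate K). [folklore] -/
theorem checkDCRow1_43_weilCert23K : weilCert23KBase.checkDCRow 1 43 = true := by
  decide +kernel

set_option maxHeartbeats 0 in
/-- Kernel check of row 44 of `D C = I` (certificate K). [folklore] -/
theorem checkDCRow1_44_weilCert23K : weilCert23KBase.checkDCRow 1 44 = true := by
  decide +kernel

set_option maxHeartbeats 0 in
/-- Kernel check of row 45 of `D C = I` (certificate K). [folklore] -/
theorem checkDCRow1_45_weilCert23K : weilCert23KBase.checkDCRow 1 45 = true := by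
  decide +kernel

set_option maxHeartbeats 0 in
/-- Kernel check of row 46 of `D C = I` (certificate K). [folklore] -/
theorem checkDCRow1_46_weilCert23K : weilCert23KBase.checkDCRow 1 46 = true := by
  decide +kernel

set_option maxHeartbeats 0 in
/-- Kernel check of row 47 of `D C = I` (certificate K). [folklore] -/
theorem checkDCRow1_47_weilCert23K : weilCert23KBase.checkDCRow 1 47 = true := by
  decide +kernel

set_option maxHeartbeats 0 in
/-- Kernel check of row 48 of `D C = I` (certificate K). [folklore] -/
theorem checkDCRow1_48_weilCert23K : weilCert23KBase.checkDCRow 1 48 = true := by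
  decide +kernel

set_option maxHeartbeats 0 in
/-- Kernel check of row 49 of `D C = I` (certificate K). [folklore] -/
theorem checkDCRow1_49_weilCert23K : weilCert23KBase.checkDCRow 1 49 = true := by
  decide +kernel

set_option maxHeartbeats 0 in
/-- Kernel check of row 50 of `D C = I` (certificate K). [folklore] -/
theorem checkDCRow1_50_weilCert23K : weilCert23KBase.checkDCRow 1 50 = true := by
  decide +kernel

set_option maxHeartbeats 0 in
/-- Kernel check of row 51 of `D C = I` (certificate K). [folklore] -/
theorem checkDCRow1_51_weilCert23K : weilCert23KBase.checkDCRow 1 51 = true := by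
  decide +kernel

set_option maxHeartbeats 0 in
/-- Kernel check of row 52 of `D C = I` (certificate K). [folklore] -/
theorem checkDCRow1_52_weilCert23K : weilCert23KBase.checkDCRow 1 52 = true := by
  decide +kernel

set_option maxHeartbeats 0 in
/-- Kernel check of row 53 of `D C = I` (certificate K). [folklore] -/
theorem checkDCRow1_53_weilCert23K : weilCert23KBase.checkDCRow 1 53 = true := by
  decide +kernel


end Literature.NumberTheory.LFunctions
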